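import Summits.BirchSwinnertonDyer.BirchSwinnertonDyer.Theses.TameQuarticManinParity
import Literature.NumberTheory.ModularSymbols.CuspidalHomologyNormImageEigensystems
import HarnessLib

/-!
# Route `TameQuarticManinParity`: H1 `TprimeIrrNormImageAvoidsThree` (stmt-BirchSwinnertonDyer-23479)
# ⟸ L31 `TprimeIrrLevelThirdAvoidsThree` (stmt-BirchSwinnertonDyer-23690), BY NAME

Lead seat `cruxlead-stmt-BirchSwinnertonDyer-23367` (crux MS `TprimeIrrModThreeSaturation`, line `abelian-fixed-points`),
landing the glue of typer defn-ty1 g30 (`H1_of_L31.lean`, evidence #4 on 23479) verbatim up to namespace: the level-`N/3`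
exclusion of the mod-`3` system `ā(W)` (L31) implies the norm-image exclusion at level `N` (H1), by the LANDED transport
theorem `Literature.NumberTheory.ModularSymbols.exists_normInt_eq_three_smul_of_level_div_three` (p674013,
`CuspidalHomologyNormImageEigensystems`: `K = Nm⁻¹(3Λ_N)`, `π_*K ⊇ 3Λ_{N/3}` is `T_p`-stable, Fitting exactness on
`Λ_{N/3}/3 ↠ Λ_{N/3}/π_*K`, `Nm = π^*π_*`). T31 `ShiftFixedLatticeIsTransfer` (stmt-23689) is NOT used: H1's cone is
exactly L31. THEOREMS ONLY; no definition, no named fact, no `sorry`. No summit is proved; BSD is NOT proved.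
-/

set_option autoImplicit false
-- D-0017: single-problem summit, so `Summit.BirchSwinnertonDyer.BirchSwinnertonDyer.…` repeats a namespace BY DESIGN.
set_option linter.dupNamespace false

noncomputable section

namespace Summit.BirchSwinnertonDyer.BirchSwinnertonDyer.Theorems.TameQuarticManinParity

open Summit.BirchSwinnertonDyer.BirchSwinnertonDyer.Theses.TameQuarticManinParity
open Literature.NumberTheory.ModularSymbols

/-- **H1 ⟸ L31** (stmt-23479 ⟸ stmt-23690, by name): the level-`N/3` exclusion of the mod-`3` system `ā(W)` implies
the norm-image exclusion at level `N`, by `exists_normInt_eq_three_smul_of_level_div_three` with `a p := a_p(W)`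
(`[NeZero (N/3)]` from `9 ∣ N`). [cite: LangeRodriguez2022, Prop. 3.5.1 and §3.2.1 (derived reading: Nm = π^*π_* on H₁)] -/
theorem normImageAvoidsThree_of_levelThird
    (h : TprimeIrrLevelThirdAvoidsThree) : TprimeIrrNormImageAvoidsThree := by
  intro W _ _ _ hCM hadd hsub hirr hv h9
  have h3 : 3 ∣ W.conductorNorm ℤ := dvd_trans (dvd_pow_self 3 two_ne_zero) h9
  haveI : NeZero (W.conductorNorm ℤ / 3) :=
    ⟨(Nat.div_pos (Nat.le_of_dvd (NeZero.pos _) h3) three_pos).ne'⟩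
  obtain ⟨S, -, hS⟩ := h W hCM hadd hsub hirr hv h9
  exact ⟨S, fun z hz ↦
    exists_normInt_eq_three_smul_of_level_div_three (W.conductorNorm ℤ) h9 S
      (fun p ↦ W.LFunction p) hS z hz⟩

end Summit.BirchSwinnertonDyer.BirchSwinnertonDyer.Theorems.TameQuarticManinParity

end
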